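import Mathlib
import HarnessLib
import Literature.MathematicalPhysics.KineticTheory.HardSphereEulerProofs
import Literature.Analysis.FluidPDE.CollisionalTransfer
import Summits.AtomisticToContinuum.HydrodynamicLimit.Theses.OneFlightGossipEngine
import Summits.AtomisticToContinuum.HydrodynamicLimit.Theorems.OneFlightGossipEngineKineticCurrentsLDAlongFamiliesWindowRenyiOrderAfterBudget

/-!
# The collisional transport stub with the RATE AFTER THE BUDGET is static — probe
# `stub_collisionalTransportFamily_rateAfterBudget` of line `Sketch`, crux `KineticCurrentsLDAlongFamilies`
# (stmt-AtomisticToContinuum-16659)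

Route `OneFlightGossipEngine`, sub-problem `HydrodynamicLimit`. The open dynamical stub S2''b
`stub_collisionalTransportFamily` of the skeleton `Cruxes/KineticCurrentsLDAlongFamilies/Lines/Sketch.lean` asks for
ONE rate `s₀ > 0` such that for EVERY kinetic time `τ` and EVERY budget `κ > 0` the exponential moment at rate `s₀` of
`|Σᵢ ϑ_s(xᵢ(r))(‖vᵢ(r)‖² − ‖vᵢ(0)‖²)/2| + |M_{J_s}(Φ_r z) − M_{J_s}(z)|` under the local Gibbs law `λ^N_s` is
`≤ e^{κ(N+1)}` over the window. This file proves the same inequality with `∃ s₀` moved AFTER `∀ τ ∀ κ`, for every `N`,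
every flow and every time `r` — from energy conservation on the good set and the Gaussian moment of the kinetic energy
alone: `|X_coll| ≤ B_ϑ(E(Φ_r z) + E(z)) = 2B_ϑE(z)`, `|ΔM_J| ≤ B_J((N+1) + 2E(z))`, hence
`s₀(|X_coll| + |ΔM_J|) ≤ s₀B_J(N+1) + s₀(2B_ϑ + 2B_J)E(z)` and `s₀ := min(κ/(2(B_J+1)), γ(κ/2)/(2B_ϑ+2B_J+1))`.
So, exactly as for S2 (`windowRenyiFamily_orderAfterBudget`), the whole dynamical content of S2''b is the
budget-uniformity (and `τ`-uniformity) of the rate: an LD upper bound with a positive slope at zero.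

References: S. Olla, S. R. S. Varadhan, H.-T. Yau, Comm. Math. Phys. 155 (1993) §2; H. Spohn, *Large Scale Dynamics of
Interacting Particles* (1991), Part I §2.3.
-/

noncomputable section

open MeasureTheory Set Filter
open scoped ENNReal Topology InnerProductSpace

namespace Summit.AtomisticToContinuum.HydrodynamicLimit.Theorems.KineticCurrentsLDAlongFamiliesSketch

open Literature.Analysis.FluidPDE (HardSphereFlow Config localMaxwellian configEnergy energyObservable
  momentumObservable)
open Literature.MathematicalPhysics.KineticTheory (T3 V3 hsDiameter localGibbsLaw localGibbsMeasure)
open Literature.Analysis.FluidPDE Literature.MathematicalPhysics.KineticTheory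
open Summit.AtomisticToContinuum.HydrodynamicLimit.Theorems.KineticCurrentsWindowLDUniformLocalGibbs
  (wre_exists_gamma)

/-- **Pathwise bound of the collisional part by the conserved energy**: on the good set, for `|ϑ| ≤ B` (`B ≥ 0`),
`|Σᵢ ϑ(xᵢ(r))(‖vᵢ(r)‖² − ‖vᵢ(0)‖²)/2| ≤ 2B·E(z)`. [folklore] -/
theorem wcr_abs_coll_le {ε : ℝ} {n : ℕ} (Φ : HardSphereFlow (Torus.geometry (Fin 3)) ε n)
    {z : Config n (Fin 3) T3} (hz : z ∈ Φ.good) {ϑ : T3 → ℝ} {B : ℝ} (hB0 : 0 ≤ B)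
    (hB : ∀ x, |ϑ x| ≤ B) (r : ℝ) :
    |∑ i, ϑ (Φ.flow r z i).1 * (‖(Φ.flow r z i).2‖ ^ 2 / 2 - ‖(z i).2‖ ^ 2 / 2)| ≤
      2 * B * configEnergy z := by
  calc |∑ i, ϑ (Φ.flow r z i).1 * (‖(Φ.flow r z i).2‖ ^ 2 / 2 - ‖(z i).2‖ ^ 2 / 2)|
      ≤ ∑ i, |ϑ (Φ.flow r z i).1 * (‖(Φ.flow r z i).2‖ ^ 2 / 2 - ‖(z i).2‖ ^ 2 / 2)| :=
        Finset.abs_sum_le_sum_abs _ _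
    _ ≤ ∑ i, B * (‖(Φ.flow r z i).2‖ ^ 2 / 2 + ‖(z i).2‖ ^ 2 / 2) := by
        refine Finset.sum_le_sum fun i _ => ?_
        rw [abs_mul]
        refine mul_le_mul (hB _) ?_ (abs_nonneg _) hB0
        have h1 : 0 ≤ ‖(Φ.flow r z i).2‖ ^ 2 / 2 := by positivity
        have h2 : 0 ≤ ‖(z i).2‖ ^ 2 / 2 := by positivity
        exact (abs_sub _ _).trans (by rw [abs_of_nonneg h1, abs_of_nonneg h2])
    _ = B * (configEnergy (Φ.flow r z) + configEnergy z) := by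
        rw [← Finset.mul_sum, Finset.sum_add_distrib]
        congr 1
        unfold configEnergy
        rw [Finset.mul_sum, Finset.mul_sum]
        congr 1 <;> exact Finset.sum_congr rfl fun i _ => by ring
    _ = 2 * B * configEnergy z := by rw [Φ.configEnergy_flow hz r]; ring

/-- **S2''b with the rate after the budget is static** — probe `stub_collisionalTransportFamily_rateAfterBudget` of line
`Sketch`: the registered open stub `stub_collisionalTransportFamily` with `∃ s₀ > 0` moved after `∀ τ ∀ κ` holds with
`N₀ = 0`, for every flow family and every `r` of the window (indeed every `r ≥ 0`), by energy conservation and the Gaussian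
moment of the kinetic energy under `λ^N_s`. It isolates the dynamical content of S2''b as the budget-uniformity of the rate.
[folklore] -/
theorem stub_collisionalTransportFamily_rateAfterBudget :
    ∀ (t₁ : ℝ) (a θ₀ : ℝ → T3 → ℝ) (u₀ : ℝ → T3 → V3),
    Continuous (Function.uncurry a) → Continuous (Function.uncurry θ₀) →
    Continuous (Function.uncurry u₀) → (∀ s x, 0 < a s x) → (∀ s x, 0 < θ₀ s x) →
    ∀ σ : ℝ, 0 < σ → σ ≤ 1 / 2 →
    ∀ (ϑ : ℝ → T3 → ℝ) (J : ℝ → T3 → V3), Continuous (Function.uncurry ϑ) →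
    Continuous (Function.uncurry J) →
    ∀ τ : ℝ, 0 < τ → ∀ κ : ℝ, 0 < κ → ∃ s₀ : ℝ, 0 < s₀ ∧
    ∀ Φ : (N : ℕ) →
      HardSphereFlow (Literature.Analysis.FluidPDE.Torus.geometry (Fin 3)) (hsDiameter σ N) (N + 1),
    ∃ N₀ : ℕ, ∀ N : ℕ, N₀ ≤ N → ∀ s ∈ Icc 0 t₁,
    ∀ r ∈ Icc (0 : ℝ) (τ * ((N : ℝ) + 1) ^ (-(1 / 3 : ℝ))),
      ∫⁻ z, ENNReal.ofReal (Real.exp (s₀ *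
          (|∑ i, ϑ s ((Φ N).flow r z i).1 *
              (‖((Φ N).flow r z i).2‖ ^ 2 / 2 - ‖(z i).2‖ ^ 2 / 2)| +
            |momentumObservable (J s) ((Φ N).flow r z) - momentumObservable (J s) z|)))
        ∂(localGibbsLaw σ (a s) (u₀ s) (θ₀ s) N (Φ N)) ≤
      ENNReal.ofReal (Real.exp (κ * ((N : ℝ) + 1))) := by
  intro t₁ a θ₀ u₀ ha hθ hu ha0 hθ0 σ _ hσ2 ϑ J hϑ hJ τ _ κ hκ
  -- uniform bounds on `[0,t₁] × 𝕋³`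
  obtain ⟨Θ, hΘ0, hΘ'⟩ := wrf_exists_forall_le_family hθ t₁
  obtain ⟨U, _, hU'⟩ := wrf_exists_forall_le_family (f := fun s x => ‖u₀ s x‖) hu.norm t₁
  obtain ⟨B₁, hB₁0, hB₁⟩ := wrf_exists_forall_le_family hϑ t₁
  obtain ⟨B₂, _, hB₂⟩ := wrf_exists_forall_le_family (f := fun s x => -ϑ s x) hϑ.neg t₁
  obtain ⟨BJ, hBJ0, hBJ⟩ := wrf_exists_forall_le_family (f := fun s x => ‖J s x‖) hJ.norm t₁
  have hBabs : ∀ s ∈ Icc (0 : ℝ) t₁, ∀ x, |ϑ s x| ≤ max B₁ B₂ := fun s hs x =>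
    abs_le.2 ⟨by linarith [hB₂ s hs x, le_max_right B₁ B₂], (hB₁ s hs x).trans (le_max_left _ _)⟩
  have hB0 : 0 ≤ max B₁ B₂ := hB₁0.le.trans (le_max_left _ _)
  -- the Gaussian exponent for `κ/2`, then the rate
  obtain ⟨γ, hγ0, hγΘ, hK⟩ := wre_exists_gamma hΘ0 (half_pos hκ) U
  obtain ⟨c, hc⟩ : ∃ c : ℝ, c = 2 * max B₁ B₂ + 2 * BJ := ⟨_, rfl⟩
  have hc0 : 0 ≤ c := by rw [hc]; positivity
  obtain ⟨s₀, hs0⟩ : ∃ s₀ : ℝ, s₀ = min (κ / (2 * (BJ + 1))) (γ / (c + 1)) := ⟨_, rfl⟩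
  have hs00 : 0 < s₀ := by rw [hs0]; exact lt_min (by positivity) (by positivity)
  have hs₁ : s₀ * BJ ≤ κ / 2 := by
    have h1 : s₀ ≤ κ / (2 * (BJ + 1)) := by rw [hs0]; exact min_le_left _ _
    rw [le_div_iff₀ (by positivity)] at h1
    nlinarith [hs00.le, hBJ0.le]
  have hs₂ : s₀ * c ≤ γ := by
    have h1 : s₀ ≤ γ / (c + 1) := by rw [hs0]; exact min_le_right _ _
    rw [le_div_iff₀ (by positivity)] at h1
    nlinarith [hs00.le, hc0]
  refine ⟨s₀, hs00, fun Φ => ⟨0, fun N _ s hsI r _ => ?_⟩⟩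
  have has : Continuous (a s) := ha.uncurry_left s
  have hθs : Continuous (θ₀ s) := hθ.uncurry_left s
  have hus : Continuous (u₀ s) := hu.uncurry_left s
  have hN0 : (0 : ℝ) ≤ (N : ℝ) + 1 := by positivity
  -- a.e. pathwise bound by the conserved energy
  have hae : ∀ᵐ z ∂(localGibbsLaw σ (a s) (u₀ s) (θ₀ s) N (Φ N)),
      ENNReal.ofReal (Real.exp (s₀ *
          (|∑ i, ϑ s ((Φ N).flow r z i).1 *
              (‖((Φ N).flow r z i).2‖ ^ 2 / 2 - ‖(z i).2‖ ^ 2 / 2)| +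
            |momentumObservable (J s) ((Φ N).flow r z) - momentumObservable (J s) z|))) ≤
        ENNReal.ofReal (Real.exp (κ / 2 * ((N : ℝ) + 1))) *
          ENNReal.ofReal (Real.exp (γ * configEnergy z)) := by
    filter_upwards [ae_mem_good_localGibbsLaw σ (a s) (u₀ s) (θ₀ s) N (Φ N)] with z hz
    rw [← ENNReal.ofReal_mul (Real.exp_nonneg _), ← Real.exp_add]
    refine ENNReal.ofReal_le_ofReal (Real.exp_le_exp.2 ?_)
    have hE0 : 0 ≤ configEnergy z := by
      show (0 : ℝ) ≤ 2⁻¹ * ∑ i, ‖(z i).2‖ ^ 2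
      exact mul_nonneg (by norm_num) (Finset.sum_nonneg fun i _ => sq_nonneg _)
    have hX := wcr_abs_coll_le (Φ N) hz hB0 (hBabs s hsI) r
    have hM₁ := wrw_abs_momentumObservable_le hBJ0.le (hBJ s hsI) z
    have hM₂ := wrw_abs_momentumObservable_le hBJ0.le (hBJ s hsI) ((Φ N).flow r z)
    rw [(Φ N).configEnergy_flow hz r] at hM₂
    have hM : |momentumObservable (J s) ((Φ N).flow r z) - momentumObservable (J s) z| ≤
        BJ * (((N : ℝ) + 1) + 2 * configEnergy z) := by
      have h := abs_sub (momentumObservable (J s) ((Φ N).flow r z)) (momentumObservable (J s) z)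
      push_cast at hM₁ hM₂
      nlinarith [h, hM₁, hM₂]
    have hsum : s₀ * (|∑ i, ϑ s ((Φ N).flow r z i).1 *
          (‖((Φ N).flow r z i).2‖ ^ 2 / 2 - ‖(z i).2‖ ^ 2 / 2)| +
        |momentumObservable (J s) ((Φ N).flow r z) - momentumObservable (J s) z|) ≤
        s₀ * BJ * ((N : ℝ) + 1) + s₀ * c * configEnergy z := by
      have h1 := add_le_add hX hM
      have h2 := mul_le_mul_of_nonneg_left h1 hs00.le
      have h3 : s₀ * (2 * max B₁ B₂ * configEnergy z + BJ * (((N : ℝ) + 1) + 2 * configEnergy z)) =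
          s₀ * BJ * ((N : ℝ) + 1) + s₀ * c * configEnergy z := by rw [hc]; ring
      linarith [h2, h3.le]
    calc s₀ * (|∑ i, ϑ s ((Φ N).flow r z i).1 *
            (‖((Φ N).flow r z i).2‖ ^ 2 / 2 - ‖(z i).2‖ ^ 2 / 2)| +
          |momentumObservable (J s) ((Φ N).flow r z) - momentumObservable (J s) z|)
        ≤ s₀ * BJ * ((N : ℝ) + 1) + s₀ * c * configEnergy z := hsum
      _ ≤ κ / 2 * ((N : ℝ) + 1) + γ * configEnergy z :=
          add_le_add (mul_le_mul_of_nonneg_right hs₁ hN0) (mul_le_mul_of_nonneg_right hs₂ hE0)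
  -- the Gaussian moment
  have hEm : Measurable fun z : Config (N + 1) (Fin 3) T3 => configEnergy z := by
    unfold configEnergy
    exact measurable_const.mul (Finset.measurable_sum _ fun i _ =>
      ((measurable_pi_apply i).snd.norm.pow_const 2))
  have hγm : Measurable fun z : Config (N + 1) (Fin 3) T3 =>
      ENNReal.ofReal (Real.exp (γ * configEnergy z)) :=
    (Real.measurable_exp.comp (measurable_const.mul hEm)).ennreal_ofReal
  have hKN : (Real.exp (γ * U ^ 2) * (1 - 2 * γ * Θ) ^ (-(3 : ℝ) / 2)) ^ (N + 1) ≤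
      Real.exp (κ / 2 * ((N : ℝ) + 1)) := by
    have hK0 : 0 ≤ Real.exp (γ * U ^ 2) * (1 - 2 * γ * Θ) ^ (-(3 : ℝ) / 2) :=
      mul_nonneg (Real.exp_nonneg _) (Real.rpow_nonneg (by linarith) _)
    refine (pow_le_pow_left₀ hK0 hK (N + 1)).trans_eq ?_
    rw [← Real.exp_nat_mul]
    congr 1
    push_cast
    ring
  have hfin : Real.exp (κ / 2 * ((N : ℝ) + 1)) * Real.exp (κ / 2 * ((N : ℝ) + 1)) =
      Real.exp (κ * ((N : ℝ) + 1)) := by rw [← Real.exp_add]; ring_nf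
  calc ∫⁻ z, ENNReal.ofReal (Real.exp (s₀ *
          (|∑ i, ϑ s ((Φ N).flow r z i).1 *
              (‖((Φ N).flow r z i).2‖ ^ 2 / 2 - ‖(z i).2‖ ^ 2 / 2)| +
            |momentumObservable (J s) ((Φ N).flow r z) - momentumObservable (J s) z|)))
        ∂(localGibbsLaw σ (a s) (u₀ s) (θ₀ s) N (Φ N))
      ≤ ∫⁻ z, ENNReal.ofReal (Real.exp (κ / 2 * ((N : ℝ) + 1))) *
          ENNReal.ofReal (Real.exp (γ * configEnergy z)) ∂(localGibbsLaw σ (a s) (u₀ s) (θ₀ s) N (Φ N)) :=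
        lintegral_mono_ae hae
    _ = ENNReal.ofReal (Real.exp (κ / 2 * ((N : ℝ) + 1))) *
          ∫⁻ z, ENNReal.ofReal (Real.exp (γ * configEnergy z)) ∂(localGibbsLaw σ (a s) (u₀ s) (θ₀ s) N (Φ N)) := by
        rw [lintegral_const_mul _ hγm]
    _ ≤ ENNReal.ofReal (Real.exp (κ / 2 * ((N : ℝ) + 1))) *
          ENNReal.ofReal ((Real.exp (γ * U ^ 2) * (1 - 2 * γ * Θ) ^ (-(3 : ℝ) / 2)) ^ (N + 1)) :=
        mul_le_mul_right (lintegral_exp_mul_configEnergy_localGibbsLaw_le has hθs hus (ha0 s) (hθ0 s) hσ2 N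
          (Φ N) hγ0.le (hΘ' s hsI) (hU' s hsI) hγΘ) _
    _ ≤ ENNReal.ofReal (Real.exp (κ / 2 * ((N : ℝ) + 1))) *
          ENNReal.ofReal (Real.exp (κ / 2 * ((N : ℝ) + 1))) :=
        mul_le_mul_right (ENNReal.ofReal_le_ofReal hKN) _
    _ = ENNReal.ofReal (Real.exp (κ * ((N : ℝ) + 1))) := by
        rw [← ENNReal.ofReal_mul (Real.exp_nonneg _), hfin]

end Summit.AtomisticToContinuum.HydrodynamicLimit.Theorems.KineticCurrentsLDAlongFamiliesSketch

end
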